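import Summits.Ventures.Crystal3D.Bulk.HullRotSysAzimuth
import Summits.Ventures.Crystal3D.Bulk.GapHullMap
import Summits.Ventures.Crystal3D.Bulk.GapFaceCorners
import Summits.Ventures.Crystal3D.Bulk.GapOrientation
import HarnessLib

/-!
# (G3), geometric half: on the tight darts of a GAP configuration the hull rotation `σ_H`
# returns first at the oriented successor `onextNbr` (`phase2/LEAN-FACES-DESIGN.md` §5.3)

HONEST FRAMING. Part of the venture `Summits/Ventures/Crystal3D` (cell `pub-crystal3d`, phase 2;
seat p3). Kernel lemmas about an admissible fourteen-ball configuration `c` (`IsGapConfig c`)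
with `intruderDist c < 3/2`; nothing here asserts anything about GAP(1.26). The directions
`gapDir c j` (`j ≠ 0`) form typer-bulk-2's `dirSet c` (`Bulk/GapHullMap.lean`: thirteen unit
vectors, `0` inside their hull), whose fan triangulation carries the hull rotation system
`hullSucc (dirSet c)` of `Bulk/HullRotSys*.lean` (seat p3, (G2)). The ORIENTED tight rotation
`onextNbr c i` (`Bulk/GapOrientation.lean`) steps to the next tight partner in the azimuth order
at `gapDir c i`, forward or backward according to `frameDet c i = ±1`; by
`Bulk/HullRotSysAzimuth.lean` the hull rotation steps to the next FAN NEIGHBOUR in the same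
azimuth order, in the direction given by the same determinant. This file proves the
identification the Euler wiring needs:

* `IsGapConfig.mk_mem_hullDarts_of_tight` — a tight pair is a hull dart (tight pairs are hull
  edges, `pair_mem_hullEdges_of_tight`, and hull edges are sides of fan triangles);
* `HullRotSys.iterate_hullSucc_nb_of_det_pos/neg` — iterating `σ_H` walks the azimuth
  enumeration forward / backward;
* **`IsGapConfig.hullSucc_firstReturn_onextNbr`** — for `i ≠ 0` and a tight partner `j`, there is
  `n ≥ 1` with `σ_H^[n] (u_i, u_j) = (u_i, u_{onextNbr c i j})` and NO iterate `σ_H^[m]`,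
  `0 < m < n`, is a tight dart: the first return of the hull rotation to the tight darts is the
  oriented tight rotation. (With typer-bulk-2's `RotSys.induce_eq_of_first_return` this says
  `induce σ_H (tight darts) = onextNbr`; the count identities and `chi2_eq_of_subset` then give
  the oriented Euler relation — the remaining, purely combinatorial half of (G3).)
-/

noncomputable section

namespace Summit.Ventures.Crystal3D

open Literature.Geometry.DiscreteGeometry Finset HullRotSys

/-! ## Iterating the hull rotation along the azimuth enumeration -/

namespace HullRotSys

variable {X : Finset (EuclideanSpace ℝ (Fin 3))} {y : EuclideanSpace ℝ (Fin 3)} {hy : ‖y‖ = 1}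

/-- With a right-handed frame, `σ_H^[n] (y, nb k) = (y, nb (k + n))`. -/
theorem iterate_hullSucc_nb_of_det_pos (hX1 : ∀ y ∈ X, ‖y‖ = 1)
    (h0 : (0 : EuclideanSpace ℝ (Fin 3)) ∈ interior (convexHull ℝ (X : Set _)))
    (E : NbrEnum X y hy)
    (hdet : 0 < orient3 (tangentFrame y hy 0) (tangentFrame y hy 1) (tangentFrame y hy 2))
    (n k : ℕ) : (hullSucc X)^[n] (y, E.nb k) = (y, E.nb (k + n)) := by
  induction n with
  | zero => rfl
  | succ n ih =>
    rw [Function.iterate_succ_apply', ih, hullSucc_mk, succV_nb_of_det_pos hX1 h0 E hdet,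
      Nat.add_assoc]

/-- With a left-handed frame, `σ_H^[n] (y, nb k) = (y, nb (k − n))` for `n ≤ k`. -/
theorem iterate_hullSucc_nb_of_det_neg (hX1 : ∀ y ∈ X, ‖y‖ = 1)
    (h0 : (0 : EuclideanSpace ℝ (Fin 3)) ∈ interior (convexHull ℝ (X : Set _)))
    (E : NbrEnum X y hy)
    (hdet : orient3 (tangentFrame y hy 0) (tangentFrame y hy 1) (tangentFrame y hy 2) < 0)
    {n k : ℕ} (hn : n ≤ k) : (hullSucc X)^[n] (y, E.nb k) = (y, E.nb (k - n)) := by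
  induction n with
  | zero => rfl
  | succ n ih =>
    rw [Function.iterate_succ_apply', ih (by omega), hullSucc_mk,
      show k - n = (k - (n + 1)) + 1 by omega, succV_nb_of_det_neg hX1 h0 E hdet]

end HullRotSys

variable {c : Fin 14 → EuclideanSpace ℝ (Fin 3)}

/-! ## Tight darts are hull darts -/

/-- `intruderDist < 3/2` implies `intruderDist² < 3`. -/
theorem IsGapConfig.sq_lt_three_of_lt (hc : IsGapConfig c) (hD : intruderDist c < 3 / 2) :
    intruderDist c ^ 2 < 3 := by
  have h1 := hc.one_le_intruderDist
  nlinarith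

/-- **A tight pair is a hull dart**: for `i ≠ 0` and a tight partner `j` of `i`,
`(gapDir c i, gapDir c j)` is a dart of the fan triangulation of `dirSet c` (the pair spans a
hull edge, `pair_mem_hullEdges_of_tight`, and a hull edge is a side of two fan triangles). -/
theorem IsGapConfig.mk_mem_hullDarts_of_tight (hc : IsGapConfig c) (hD : intruderDist c < 3 / 2)
    {i j : Fin 14} (hi0 : i ≠ 0) (hj : j ∈ tightNbrs c i) :
    (gapDir c i, gapDir c j) ∈ hullDarts (dirSet c) := by
  obtain ⟨hj0, hji, hdist⟩ := mem_tightNbrs.1 hj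
  have hD2 : intruderDist c < 2 := by linarith
  have hedge := hc.pair_mem_hullEdges_of_tight hD hi0 hj0 hdist
  have h2 := card_filter_fanTriSets_eq_two_of_mem_hullEdges hc.norm_of_mem_dirSet
    hc.zero_mem_interior_convexHull_dirSet hedge
  obtain ⟨t, ht⟩ : ((fanTriSets (dirSet c)).filter fun t' =>
      ({gapDir c i, gapDir c j} : Finset _) ⊆ t').Nonempty := by
    rw [← Finset.card_pos, h2]; exact Nat.succ_pos 1
  rw [mem_filter, insert_subset_iff, singleton_subset_iff] at ht
  exact mk_mem_hullDarts ht.1 ht.2.1 ht.2.2 (hc.gapDir_ne hD2 hi0 hj0 (Ne.symm hji))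

/-! ## Positions of the tight partners in the fan enumeration -/

section Positions

variable (hc : IsGapConfig c) {i : Fin 14} (hi0 : i ≠ 0) {k : ℕ}
  (hd : (tightAngles c i).card = k + 1) (E : NbrEnum (dirSet c) (gapDir c i) (hc.norm_gapDir hi0))
  (K : Fin (k + 1) → ℕ)
  (hK : ∀ p, K p < E.d ∧ E.nb (K p) = gapDir c (tightNbrAt c i hd p))

include hK in
/-- The azimuth of the fan neighbour at position `K p` is the `p`-th sorted tight azimuth. -/
theorem tightPos_azimuth (p : Fin (k + 1)) :
    azimuth (gapDir c i) (hc.norm_gapDir hi0) (E.nb (K p)) = sortedTightAngle c i hd p := by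
  rw [(hK p).2, ← hc.tightAzimuth_eq hi0, tightAzimuth_tightNbrAt]

include hK in
/-- The position map is strictly increasing. -/
theorem tightPos_lt_of_lt {p q : Fin (k + 1)} (hpq : p < q) : K p < K q := by
  by_contra hle
  rw [not_lt] at hle
  have hs : sortedTightAngle c i hd p < sortedTightAngle c i hd q :=
    (sortedTightAngle c i hd).strictMono hpq
  rw [← tightPos_azimuth hc hi0 hd E K hK p, ← tightPos_azimuth hc hi0 hd E K hK q] at hs
  rcases hle.lt_or_eq with hlt | heq
  · exact absurd hs (not_lt.2 (E.mono _ _ hlt (hK p).1).le)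
  · rw [heq] at hs; exact lt_irrefl _ hs

include hK in
/-- The position map is monotone. -/
theorem tightPos_le_of_le {p q : Fin (k + 1)} (hpq : p ≤ q) : K p ≤ K q := by
  rcases hpq.lt_or_eq with hlt | heq
  · exact (tightPos_lt_of_lt hc hi0 hd E K hK hlt).le
  · rw [heq]

include hK in
/-- The position map reflects the order. -/
theorem lt_of_tightPos_lt {p q : Fin (k + 1)} (hpq : K p < K q) : p < q := by
  by_contra hle
  rw [not_lt] at hle
  exact absurd hpq (not_lt.2 (tightPos_le_of_le hc hi0 hd E K hK hle))

include hK in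
/-- A fan neighbour (position `< d`) that is a tight direction sits at some `K p`. -/
theorem exists_tightPos_eq (hD : intruderDist c < 3 / 2) {m : ℕ} (hm : m < E.d)
    (ht : E.nb m ∈ (tightNbrs c i).image (gapDir c)) : ∃ p : Fin (k + 1), K p = m := by
  obtain ⟨j, hj, hjm⟩ := mem_image.1 ht
  obtain ⟨p, rfl⟩ := hc.exists_tightNbrAt_eq (hc.sq_lt_three_of_lt hD) hi0 hd hj
  refine ⟨p, E.nb_inj (hK p).1 hm ?_⟩
  rw [(hK p).2, hjm]

end Positions

/-! ## The first return of the hull rotation to the tight darts -/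

/-- **First return of `σ_H` to the tight darts = the oriented tight rotation.** For an admissible
configuration with `intruderDist c < 3/2`, a ball `i ≠ 0` and a tight partner `j` of `i`: some
iterate `σ_H^[n]`, `n ≥ 1`, of the hull rotation of `dirSet c` carries the dart
`(gapDir c i, gapDir c j)` to `(gapDir c i, gapDir c (onextNbr c i j))`, and no earlier positive
iterate is a tight dart. -/
theorem IsGapConfig.hullSucc_firstReturn_onextNbr (hc : IsGapConfig c)
    (hD : intruderDist c < 3 / 2) {i j : Fin 14} (hi0 : i ≠ 0) (hj : j ∈ tightNbrs c i) :
    ∃ n : ℕ, 0 < n ∧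
      (hullSucc (dirSet c))^[n] (gapDir c i, gapDir c j) =
        (gapDir c i, gapDir c (onextNbr c i j)) ∧
      ∀ m : ℕ, 0 < m → m < n →
        ((hullSucc (dirSet c))^[m] (gapDir c i, gapDir c j)).2 ∉ (tightNbrs c i).image (gapDir c)
            := by
  classical
  have hD3 := hc.sq_lt_three_of_lt hD
  have hy : ‖gapDir c i‖ = 1 := hc.norm_gapDir hi0
  have hX1 := hc.norm_of_mem_dirSet
  have h0 := hc.zero_mem_interior_convexHull_dirSet
  -- the azimuth enumeration of the fan neighbours of `gapDir c i`
  have hfan : gapDir c j ∈ fanNbrs (dirSet c) (gapDir c i) :=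
    mk_mem_hullDarts_iff.1 (hc.mk_mem_hullDarts_of_tight hD hi0 hj)
  obtain ⟨E⟩ := nonempty_nbrEnum hX1 hy ⟨gapDir c j, hfan⟩
  -- positions of the tight partners
  obtain ⟨k, hd⟩ := hc.exists_card_tightAngles_eq_succ hD3 hi0 ⟨j, hj⟩
  obtain ⟨m, rfl⟩ := hc.exists_tightNbrAt_eq hD3 hi0 hd hj
  have hsurj : ∀ p : Fin (k + 1), ∃ q : ℕ, q < E.d ∧ E.nb q = gapDir c (tightNbrAt c i hd p) :=
    fun p => E.surj _ (mk_mem_hullDarts_iff.1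
      (hc.mk_mem_hullDarts_of_tight hD hi0 (tightNbrAt_mem c i hd p)))
  choose K hK using hsurj
  have hKm : K m < E.d := (hK m).1
  have hK0 : K 0 < E.d := (hK 0).1
  have hKlast : K (Fin.last k) < E.d := (hK (Fin.last k)).1
  have hKlt := fun p q (h : p < q) => tightPos_lt_of_lt hc hi0 hd E K hK h
  have hKle := fun p q (h : p ≤ q) => tightPos_le_of_le hc hi0 hd E K hK h
  have hrefl := fun p q (h : K p < K q) => lt_of_tightPos_lt hc hi0 hd E K hK h
  have hrec := fun q (hq : q < E.d) ht => exists_tightPos_eq hc hi0 hd E K hK hD hq ht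
  have hd0 := E.d_pos
  -- rewrite the start dart through its position
  rw [← (hK m).2]
  rcases frameDet_eq_one_or c i with hdet1 | hdetm
  · -- right-handed frame: `σ_H` and `onextNbr = nextNbr` both step FORWARD in azimuth
    have hdet : 0 < orient3 (tangentFrame (gapDir c i) hy 0) (tangentFrame (gapDir c i) hy 1)
        (tangentFrame (gapDir c i) hy 2) := by rw [← frameDet_eq hy, hdet1]; exact one_pos
    have hit := iterate_hullSucc_nb_of_det_pos hX1 h0 E hdet
    have honext : onextNbr c i (tightNbrAt c i hd m) = tightNbrAt c i hd (finRotate (k + 1) m) := by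
      unfold onextNbr; rw [if_pos hdet1, nextNbr_tightNbrAt]
    rw [honext, ← (hK (finRotate (k + 1) m)).2]
    by_cases hlast : m = Fin.last k
    · -- wrap-around: the successor is position `0`
      have hrot : finRotate (k + 1) m = 0 := by
        rw [hlast]; exact finRotate_last
      rw [hrot]
      refine ⟨E.d - K m + K 0, by have := (hK m).1; omega, ?_, ?_⟩
      · rw [hit, show K m + (E.d - K m + K 0) = K 0 + E.d by have := (hK m).1; omega,
          E.periodic]
      · intro n hn0 hn ht
        rw [hit] at ht
        simp only at ht
        by_cases hlt : K m + n < E.d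
        · obtain ⟨p, hp⟩ := hrec _ hlt ht
          have : m < p := hrefl m p (by omega)
          rw [hlast] at this
          exact absurd this (not_lt.2 (Fin.le_last p))
        · have hper : E.nb (K m + n) = E.nb (K m + n - E.d) := by
            conv_lhs => rw [show K m + n = (K m + n - E.d) + E.d by omega, E.periodic]
          rw [hper] at ht
          obtain ⟨p, hp⟩ := hrec _ (by omega) ht
          have : p < 0 := hrefl p 0 (by omega)
          exact absurd this (not_lt.2 (Fin.zero_le p))
    · -- interior: the successor is position `m + 1`
      have hval : ((finRotate (k + 1) m : Fin (k + 1)) : ℕ) = (m : ℕ) + 1 := by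
        rw [finRotate_apply, Fin.val_add_one, if_neg hlast]
      have hmlt : m < finRotate (k + 1) m := by
        rw [Fin.lt_def, hval]; exact Nat.lt_succ_self _
      have hKml : K m < K (finRotate (k + 1) m) := hKlt _ _ hmlt
      refine ⟨K (finRotate (k + 1) m) - K m, by omega, ?_, ?_⟩
      · rw [hit, Nat.add_sub_cancel' hKml.le]
      · intro n hn0 hn ht
        rw [hit] at ht
        simp only at ht
        obtain ⟨p, hp⟩ := hrec _ (by have := (hK (finRotate (k + 1) m)).1; omega) ht
        have h1 : m < p := hrefl m p (by omega)
        have h2 : p < finRotate (k + 1) m := hrefl p _ (by omega)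
        rw [Fin.lt_def] at h1 h2
        omega
  · -- left-handed frame: `σ_H` and `onextNbr = prevNbr` both step BACKWARD in azimuth
    have hne1 : frameDet c i ≠ 1 := by rw [hdetm]; norm_num
    have hdet : orient3 (tangentFrame (gapDir c i) hy 0) (tangentFrame (gapDir c i) hy 1)
        (tangentFrame (gapDir c i) hy 2) < 0 := by
      rw [← frameDet_eq hy, hdetm]; norm_num
    have hit := fun n q (h : n ≤ q) => iterate_hullSucc_nb_of_det_neg hX1 h0 E hdet (n := n) (k
        := q) h
    have honext : onextNbr c i (tightNbrAt c i hd m) =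
        tightNbrAt c i hd ((finRotate (k + 1)).symm m) := by
      unfold onextNbr; rw [if_neg hne1, prevNbr_tightNbrAt]
    set m' := (finRotate (k + 1)).symm m with hm'
    have hmm' : m = finRotate (k + 1) m' := by rw [hm', Equiv.apply_symm_apply]
    have hKm' : K m' < E.d := (hK m').1
    rw [honext, ← (hK m').2]
    -- start from the shifted index `K m + d` so that backward steps stay in `ℕ`
    have hstart : E.nb (K m) = E.nb (K m + E.d) := (E.periodic _).symm
    rw [hstart]
    by_cases hlast : m' = Fin.last k
    · -- wrap-around: `m = 0`, the predecessor is the LAST position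
      have hm0 : m = 0 := by rw [hmm', hlast]; exact finRotate_last
      refine ⟨K m + E.d - K m', by have := (hK m').1; omega, ?_, ?_⟩
      · rw [hit _ _ (by omega), show K m + E.d - (K m + E.d - K m') = K m' by
          have := (hK m').1; omega]
      · intro n hn0 hn ht
        rw [hit _ _ (by have := (hK m').1; omega)] at ht
        simp only at ht
        by_cases hge : E.d ≤ K m + E.d - n
        · have hper : E.nb (K m + E.d - n) = E.nb (K m + E.d - n - E.d) := by
            conv_lhs => rw [show K m + E.d - n = (K m + E.d - n - E.d) + E.d by omega, E.periodic]
          rw [hper] at ht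
          obtain ⟨p, hp⟩ := hrec _ (by omega) ht
          have : p < m := hrefl p m (by omega)
          rw [hm0] at this
          exact absurd this (not_lt.2 (Fin.zero_le p))
        · obtain ⟨p, hp⟩ := hrec _ (by omega) ht
          have : m' < p := hrefl m' p (by have := (hK m').1; omega)
          rw [hlast] at this
          exact absurd this (not_lt.2 (Fin.le_last p))
    · -- interior: `m = m' + 1`, the predecessor is position `m'`
      have hval : ((m : Fin (k + 1)) : ℕ) = (m' : ℕ) + 1 := by
        rw [hmm', finRotate_apply, Fin.val_add_one, if_neg hlast]
      have hm'lt : m' < m := by rw [Fin.lt_def, hval]; exact Nat.lt_succ_self _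
      have hKml : K m' < K m := hKlt _ _ hm'lt
      refine ⟨K m - K m', by omega, ?_, ?_⟩
      · rw [hit _ _ (by omega), show K m + E.d - (K m - K m') = K m' + E.d by omega, E.periodic]
      · intro n hn0 hn ht
        rw [hit _ _ (by omega), show K m + E.d - n = (K m - n) + E.d by omega, E.periodic] at ht
        simp only at ht
        obtain ⟨p, hp⟩ := hrec _ (by have := (hK m).1; omega) ht
        have h1 : m' < p := hrefl m' p (by omega)
        have h2 : p < m := hrefl p m (by omega)
        rw [Fin.lt_def] at h1 h2
        omega

end Summit.Ventures.Crystal3D
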